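import Summits.QuantumFields.YangMills.Theorems.PoincareLipschitzSobolevShellInterpolation
import Literature.Analysis.Calculus.RadialCutoff
import Mathlib.Analysis.Calculus.LocalExtr.Basic
import HarnessLib

/-!
# LINE 25 «CompactnessTransfer» (K2 crux `BlockLipschitzL` stmt-QuantumFields-23533 ∕ crux `HistoryTailL` stmt-QuantumFields-19936), S1″ row (C)
# «MinimisingMapCompactness» proof project (w2 g13 lineage), brick (C-c′) «THE INTERPOLANT ACROSS TWO CONCENTRIC BALLS, PACKAGED»:
# the (C-c) interpolant `w = χv + (1−χ)u` with the TREE's radial cut-off `χ` (`χ = 1` on `B̄_{ρ₁}(y)`, `χ = 0` off `B_{ρ₂}(y)`,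
# `‖∇χ‖ ≤ M/(ρ₂ − ρ₁)`), with the two caps glued EVERYWHERE (`Gw = Gv` on `B̄_{ρ₁}`, `Gw = Gu` off `B_{ρ₂}`) and the energy rows

Cell `ym3-torus` (YM ladder rung R3 = continuum SU(2) Yang–Mills on the three-torus — a RUNG, NOT the Clay problem: not `d = 4`, not infinite volume,
not a mass gap); width seat `ym-ust-19936-w4` gen 15 (offer A of 2026-08-29T14:28Z).  THEOREMS ONLY (def-free); `--supports` the K2 crux as a helper.
LETTERS = ✓(C-c) `PoincareLipschitzSobolevShellInterpolation` (w2 g13's frozen letters): maps `u v : ℝ³ → ℝ⁴` on an open `Ω` with weak gradients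
`Gu, Gv` (lit `HasWeakFDerivOn Ω volume`), the S1″ density `Σᵢ ‖G x (single i 1)‖²`, the interpolant `w x = χ x • v x + (1 − χ x) • u x` and
`Gw x = χ x • Gv x + (1 − χ x) • Gu x + (fderiv ℝ χ x).smulRight (v x − u x)` carried with defining hypotheses `hw`, `hGw`.
* §1 pointwise letters: `fderiv_eq_zero_of_chi_eq_one` ∕ `fderiv_eq_zero_of_chi_eq_zero` (`0 ≤ χ ≤ 1` ⇒ `∇χ = 0` at the extrema, by
  `IsLocalMax∕Min.fderiv_eq_zero`), hence ★`interpolantGrad_eq_of_chi_eq_one : Gw x = Gv x` and ★`interpolantGrad_eq_of_chi_eq_zero : Gw x = Gu x`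
  (EVERY such `x`, not a.e.); `norm_interpolant_sub_left_le : ‖w x − u x‖ ≤ ‖v x − u x‖`, `norm_interpolant_sub_right_le : ‖w x − v x‖ ≤ ‖v x − u x‖`;
  `norm_interpolant_le_one_of_le` (sub-unit inputs suffice).
* §2 ★★★`exists_ball_interpolant` — with the tree cut-off ✓`Literature.Analysis.Calculus.exists_radial_cutoff_gradient_le`: one absolute `M ≥ 0` such that
  for all `Ω, u, v, Gu, Gv` Sobolev and all `y`, `0 < ρ₁ < ρ₂` there are `χ, w, Gw` with the (C-c) defining rows, `ContDiff ℝ ∞ χ`, `0 ≤ χ ≤ 1`,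
  `‖∇χ‖ ≤ M/(ρ₂ − ρ₁)`, `HasWeakFDerivOn Ω volume w Gw`, `w = v ∧ Gw = Gv` on `{dist x y ≤ ρ₁}`, `w = u ∧ Gw = Gu` on `{ρ₂ ≤ dist x y}`;
  ★★★`exists_ball_interpolant_energy` — the same with `χ` hidden and the energy rows of ✓(C-c) folded in (unit inputs with integrable densities):
  sub-unit on `Ω`, the pointwise row `dens Gw ≤ 3(dens Gv + dens Gu + (M/(ρ₂−ρ₁))²‖v − u‖²)`, and on every finite-volume measurable `S ⊆ Ω`
  integrability of `dens Gw` with `∫_S dens Gw ≤ 3(∫_S dens Gv + ∫_S dens Gu + (M/(ρ₂−ρ₁))²∫_S ‖v − u‖²)`.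
HONEST: a packaging letter; (C) `MinimisingMapCompactness`, (RS), S1″, the organ, K1, `MeanDeviationL`, `BlockLipschitzL`, `HistoryTailL` are NOT proved here.
[folklore] ([Simon1996] §2.8 the cut-off comparison map; [HardtKinderlehrerLin1986] §2; [Evans2010] §5.2.3).
-/

set_option autoImplicit false

noncomputable section

open MeasureTheory Set Filter Topology TopologicalSpace Metric
open scoped NNReal BigOperators ContDiff

namespace Summit.QuantumFields.YangMills.Theorems.PoincareLipschitzSobolevShellInterpolationBalls

open Literature.Analysis.FunctionSpaces (HasWeakFDerivOn)
open Summit.QuantumFields.YangMills.Theorems.PoincareLipschitzSobolevShellInterpolation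

/-! ## §1 Pointwise letters: the gradient of the interpolant on the two caps -/

/-- With `0 ≤ χ ≤ 1`, the point `x` with `χ x = 1` is a (global, hence local) maximum, so `fderiv ℝ χ x = 0` (no differentiability needed:
Mathlib's `fderiv` is `0` at a non-differentiable point as well). [folklore] -/
theorem fderiv_eq_zero_of_chi_eq_one {χ : EuclideanSpace ℝ (Fin 3) → ℝ} (hχ01 : ∀ x, 0 ≤ χ x ∧ χ x ≤ 1)
    {x : EuclideanSpace ℝ (Fin 3)} (hx : χ x = 1) : fderiv ℝ χ x = 0 :=
  IsLocalMax.fderiv_eq_zero (Filter.Eventually.of_forall fun y => by rw [hx]; exact (hχ01 y).2)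

/-- With `0 ≤ χ ≤ 1`, the point `x` with `χ x = 0` is a minimum, so `fderiv ℝ χ x = 0`. [folklore] -/
theorem fderiv_eq_zero_of_chi_eq_zero {χ : EuclideanSpace ℝ (Fin 3) → ℝ} (hχ01 : ∀ x, 0 ≤ χ x ∧ χ x ≤ 1)
    {x : EuclideanSpace ℝ (Fin 3)} (hx : χ x = 0) : fderiv ℝ χ x = 0 :=
  IsLocalMin.fderiv_eq_zero (Filter.Eventually.of_forall fun y => by rw [hx]; exact (hχ01 y).1)

/-- ★ **where `χ = 1` the interpolant's gradient is `Gv` — at EVERY such point.** [folklore] -/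
theorem interpolantGrad_eq_of_chi_eq_one {u v : EuclideanSpace ℝ (Fin 3) → EuclideanSpace ℝ (Fin 4)}
    {Gu Gv Gw : EuclideanSpace ℝ (Fin 3) → (EuclideanSpace ℝ (Fin 3) →L[ℝ] EuclideanSpace ℝ (Fin 4))}
    {χ : EuclideanSpace ℝ (Fin 3) → ℝ} (hχ01 : ∀ x, 0 ≤ χ x ∧ χ x ≤ 1)
    (hGw : ∀ x, Gw x = χ x • Gv x + (1 - χ x) • Gu x + (fderiv ℝ χ x).smulRight (v x - u x))
    {x : EuclideanSpace ℝ (Fin 3)} (hx : χ x = 1) : Gw x = Gv x := by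
  rw [hGw x, fderiv_eq_zero_of_chi_eq_one hχ01 hx, hx]
  ext1 z
  simp

/-- ★ **where `χ = 0` the interpolant's gradient is `Gu` — at EVERY such point.** [folklore] -/
theorem interpolantGrad_eq_of_chi_eq_zero {u v : EuclideanSpace ℝ (Fin 3) → EuclideanSpace ℝ (Fin 4)}
    {Gu Gv Gw : EuclideanSpace ℝ (Fin 3) → (EuclideanSpace ℝ (Fin 3) →L[ℝ] EuclideanSpace ℝ (Fin 4))}
    {χ : EuclideanSpace ℝ (Fin 3) → ℝ} (hχ01 : ∀ x, 0 ≤ χ x ∧ χ x ≤ 1)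
    (hGw : ∀ x, Gw x = χ x • Gv x + (1 - χ x) • Gu x + (fderiv ℝ χ x).smulRight (v x - u x))
    {x : EuclideanSpace ℝ (Fin 3)} (hx : χ x = 0) : Gw x = Gu x := by
  rw [hGw x, fderiv_eq_zero_of_chi_eq_zero hχ01 hx, hx]
  ext1 z
  simp

/-- `‖w x − u x‖ ≤ ‖v x − u x‖` (`w − u = χ • (v − u)`, `0 ≤ χ ≤ 1`). [folklore] -/
theorem norm_interpolant_sub_left_le {u v w : EuclideanSpace ℝ (Fin 3) → EuclideanSpace ℝ (Fin 4)}
    {χ : EuclideanSpace ℝ (Fin 3) → ℝ} (hχ01 : ∀ x, 0 ≤ χ x ∧ χ x ≤ 1)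
    (hw : ∀ x, w x = χ x • v x + (1 - χ x) • u x) (x : EuclideanSpace ℝ (Fin 3)) :
    ‖w x - u x‖ ≤ ‖v x - u x‖ := by
  have h : w x - u x = χ x • (v x - u x) := by
    rw [hw x, smul_sub, sub_smul, one_smul]
    abel
  rw [h, norm_smul, Real.norm_eq_abs, abs_of_nonneg (hχ01 x).1]
  exact mul_le_of_le_one_left (norm_nonneg _) (hχ01 x).2

/-- `‖w x − v x‖ ≤ ‖v x − u x‖` (`w − v = (1 − χ) • (u − v)`). [folklore] -/
theorem norm_interpolant_sub_right_le {u v w : EuclideanSpace ℝ (Fin 3) → EuclideanSpace ℝ (Fin 4)}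
    {χ : EuclideanSpace ℝ (Fin 3) → ℝ} (hχ01 : ∀ x, 0 ≤ χ x ∧ χ x ≤ 1)
    (hw : ∀ x, w x = χ x • v x + (1 - χ x) • u x) (x : EuclideanSpace ℝ (Fin 3)) :
    ‖w x - v x‖ ≤ ‖v x - u x‖ := by
  have h : w x - v x = (1 - χ x) • (u x - v x) := by
    rw [hw x, smul_sub, sub_smul, one_smul, sub_smul, one_smul]
    abel
  rw [h, norm_smul, Real.norm_eq_abs, abs_of_nonneg (by linarith [(hχ01 x).2]), norm_sub_rev (u x)]
  exact mul_le_of_le_one_left (norm_nonneg _) (by linarith [(hχ01 x).1])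

/-- Sub-unit inputs suffice for a sub-unit interpolant: `‖u x‖ ≤ 1`, `‖v x‖ ≤ 1`, `0 ≤ χ x ≤ 1` ⇒ `‖w x‖ ≤ 1`. [folklore] -/
theorem norm_interpolant_le_one_of_le {u v w : EuclideanSpace ℝ (Fin 3) → EuclideanSpace ℝ (Fin 4)}
    {χ : EuclideanSpace ℝ (Fin 3) → ℝ} (hχ01 : ∀ x, 0 ≤ χ x ∧ χ x ≤ 1)
    (hw : ∀ x, w x = χ x • v x + (1 - χ x) • u x) {x : EuclideanSpace ℝ (Fin 3)}
    (hu1 : ‖u x‖ ≤ 1) (hv1 : ‖v x‖ ≤ 1) : ‖w x‖ ≤ 1 := by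
  rw [hw x]
  have hχ0 := (hχ01 x).1
  have hχ1 := (hχ01 x).2
  calc ‖χ x • v x + (1 - χ x) • u x‖ ≤ ‖χ x • v x‖ + ‖(1 - χ x) • u x‖ := norm_add_le _ _
    _ = χ x * ‖v x‖ + (1 - χ x) * ‖u x‖ := by
        rw [norm_smul, norm_smul, Real.norm_eq_abs, Real.norm_eq_abs, abs_of_nonneg hχ0, abs_of_nonneg (by linarith)]
    _ ≤ χ x * 1 + (1 - χ x) * 1 :=
        add_le_add (mul_le_mul_of_nonneg_left hv1 hχ0) (mul_le_mul_of_nonneg_left hu1 (by linarith))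
    _ = 1 := by ring

/-! ## §2 The packaged interpolant across two concentric balls -/

/-- ★★★ **THE INTERPOLANT ACROSS TWO BALLS, `χ` EXPOSED.**  There is an absolute `M ≥ 0` such that for every open `Ω ⊆ ℝ³`, all Sobolev
`u, v` on `Ω` with weak gradients `Gu, Gv`, every centre `y` and radii `0 < ρ₁ < ρ₂` there are `χ, w, Gw` with: the (C-c) defining rows
`w = χ•v + (1−χ)•u`, `Gw = χ•Gv + (1−χ)•Gu + (∇χ).smulRight (v − u)`; `ContDiff ℝ ∞ χ`, `0 ≤ χ ≤ 1`, `‖fderiv ℝ χ x‖ ≤ M/(ρ₂ − ρ₁)`;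
`HasWeakFDerivOn Ω volume w Gw`; and the caps `w = v ∧ Gw = Gv` on `{dist x y ≤ ρ₁}`, `w = u ∧ Gw = Gu` on `{ρ₂ ≤ dist x y}` (everywhere).
Every ✓(C-c) row applies to these `χ, w, Gw` by name with `L := M/(ρ₂ − ρ₁)`. [folklore] [cite: Simon1996, §2.8] -/
theorem exists_ball_interpolant : ∃ M : ℝ, 0 ≤ M ∧
    ∀ (Ω : Opens (EuclideanSpace ℝ (Fin 3))) (u v : EuclideanSpace ℝ (Fin 3) → EuclideanSpace ℝ (Fin 4))
      (Gu Gv : EuclideanSpace ℝ (Fin 3) → (EuclideanSpace ℝ (Fin 3) →L[ℝ] EuclideanSpace ℝ (Fin 4))),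
      HasWeakFDerivOn Ω volume u Gu → HasWeakFDerivOn Ω volume v Gv →
      ∀ (y : EuclideanSpace ℝ (Fin 3)) (ρ₁ ρ₂ : ℝ), 0 < ρ₁ → ρ₁ < ρ₂ →
      ∃ (χ : EuclideanSpace ℝ (Fin 3) → ℝ) (w : EuclideanSpace ℝ (Fin 3) → EuclideanSpace ℝ (Fin 4))
        (Gw : EuclideanSpace ℝ (Fin 3) → (EuclideanSpace ℝ (Fin 3) →L[ℝ] EuclideanSpace ℝ (Fin 4))),
        ContDiff ℝ ∞ χ ∧ (∀ x, 0 ≤ χ x ∧ χ x ≤ 1) ∧ (∀ x, ‖fderiv ℝ χ x‖ ≤ M / (ρ₂ - ρ₁)) ∧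
        (∀ x, w x = χ x • v x + (1 - χ x) • u x) ∧
        (∀ x, Gw x = χ x • Gv x + (1 - χ x) • Gu x + (fderiv ℝ χ x).smulRight (v x - u x)) ∧
        HasWeakFDerivOn Ω volume w Gw ∧
        (∀ x, dist x y ≤ ρ₁ → w x = v x ∧ Gw x = Gv x) ∧
        (∀ x, ρ₂ ≤ dist x y → w x = u x ∧ Gw x = Gu x) := by
  obtain ⟨M, hM0, hrad⟩ :=
    Literature.Analysis.Calculus.exists_radial_cutoff_gradient_le (E := EuclideanSpace ℝ (Fin 3))
  refine ⟨M, hM0, fun Ω u v Gu Gv hu hv y ρ₁ ρ₂ h1 h12 => ?_⟩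
  obtain ⟨χ, hχs, hχ0, hχ1, hone, hzero, -, hgrad⟩ := hrad y ρ₁ ρ₂ h1 h12
  have hχ01 : ∀ x, 0 ≤ χ x ∧ χ x ≤ 1 := fun x => ⟨hχ0 x, hχ1 x⟩
  set w : EuclideanSpace ℝ (Fin 3) → EuclideanSpace ℝ (Fin 4) := fun x => χ x • v x + (1 - χ x) • u x with hwdef
  set Gw : EuclideanSpace ℝ (Fin 3) → (EuclideanSpace ℝ (Fin 3) →L[ℝ] EuclideanSpace ℝ (Fin 4)) :=
    fun x => χ x • Gv x + (1 - χ x) • Gu x + (fderiv ℝ χ x).smulRight (v x - u x) with hGwdef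
  have hw : ∀ x, w x = χ x • v x + (1 - χ x) • u x := fun _ => rfl
  have hGw : ∀ x, Gw x = χ x • Gv x + (1 - χ x) • Gu x + (fderiv ℝ χ x).smulRight (v x - u x) := fun _ => rfl
  refine ⟨χ, w, Gw, hχs, hχ01, hgrad, hw, hGw, hasWeakFDerivOn_interpolant hu hv hχs hw hGw,
    fun x hx => ⟨interpolant_eq_of_chi_eq_one hw (hone x hx), interpolantGrad_eq_of_chi_eq_one hχ01 hGw (hone x hx)⟩,
    fun x hx => ⟨interpolant_eq_of_chi_eq_zero hw (hzero x hx), interpolantGrad_eq_of_chi_eq_zero hχ01 hGw (hzero x hx)⟩⟩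

/-- ★★★ **THE INTERPOLANT ACROSS TWO BALLS, WITH THE ENERGY ROWS** (`χ` hidden).  One absolute `M ≥ 0`; for unit Sobolev `u, v` on `Ω` with
integrable densities, every `y` and `0 < ρ₁ < ρ₂`: some `w, Gw` with `HasWeakFDerivOn Ω volume w Gw`, `‖w‖ ≤ 1` on `Ω`, the caps
`w = v ∧ Gw = Gv` on `{dist x y ≤ ρ₁}` and `w = u ∧ Gw = Gu` on `{ρ₂ ≤ dist x y}`, `‖w − u‖ ≤ ‖v − u‖` and `‖w − v‖ ≤ ‖v − u‖` pointwise,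
the pointwise energy row `dens Gw ≤ 3(dens Gv + dens Gu + (M/(ρ₂−ρ₁))²‖v − u‖²)`, and on every finite-volume measurable `S ⊆ Ω`:
`dens Gw` integrable on `S` with `∫_S dens Gw ≤ 3(∫_S dens Gv + ∫_S dens Gu + (M/(ρ₂−ρ₁))²·∫_S ‖v − u‖²)`.
[folklore] [cite: Simon1996, §2.8] [cite: HardtKinderlehrerLin1986, §2] -/
theorem exists_ball_interpolant_energy : ∃ M : ℝ, 0 ≤ M ∧
    ∀ (Ω : Opens (EuclideanSpace ℝ (Fin 3))) (u v : EuclideanSpace ℝ (Fin 3) → EuclideanSpace ℝ (Fin 4))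
      (Gu Gv : EuclideanSpace ℝ (Fin 3) → (EuclideanSpace ℝ (Fin 3) →L[ℝ] EuclideanSpace ℝ (Fin 4))),
      HasWeakFDerivOn Ω volume u Gu → HasWeakFDerivOn Ω volume v Gv →
      (∀ x ∈ (Ω : Set (EuclideanSpace ℝ (Fin 3))), ‖u x‖ = 1) → (∀ x ∈ (Ω : Set (EuclideanSpace ℝ (Fin 3))), ‖v x‖ = 1) →
      IntegrableOn (fun x => ∑ i : Fin 3, ‖Gu x (EuclideanSpace.single i (1:ℝ))‖ ^ 2) (Ω : Set _) volume →
      IntegrableOn (fun x => ∑ i : Fin 3, ‖Gv x (EuclideanSpace.single i (1:ℝ))‖ ^ 2) (Ω : Set _) volume →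
      ∀ (y : EuclideanSpace ℝ (Fin 3)) (ρ₁ ρ₂ : ℝ), 0 < ρ₁ → ρ₁ < ρ₂ →
      ∃ (w : EuclideanSpace ℝ (Fin 3) → EuclideanSpace ℝ (Fin 4))
        (Gw : EuclideanSpace ℝ (Fin 3) → (EuclideanSpace ℝ (Fin 3) →L[ℝ] EuclideanSpace ℝ (Fin 4))),
        HasWeakFDerivOn Ω volume w Gw ∧
        (∀ x ∈ (Ω : Set (EuclideanSpace ℝ (Fin 3))), ‖w x‖ ≤ 1) ∧
        (∀ x, dist x y ≤ ρ₁ → w x = v x ∧ Gw x = Gv x) ∧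
        (∀ x, ρ₂ ≤ dist x y → w x = u x ∧ Gw x = Gu x) ∧
        (∀ x, ‖w x - u x‖ ≤ ‖v x - u x‖ ∧ ‖w x - v x‖ ≤ ‖v x - u x‖) ∧
        (∀ x, ∑ i : Fin 3, ‖Gw x (EuclideanSpace.single i (1:ℝ))‖ ^ 2 ≤
          3 * (∑ i : Fin 3, ‖Gv x (EuclideanSpace.single i (1:ℝ))‖ ^ 2 + ∑ i : Fin 3, ‖Gu x (EuclideanSpace.single i (1:ℝ))‖ ^ 2 +
            (M / (ρ₂ - ρ₁)) ^ 2 * ‖v x - u x‖ ^ 2)) ∧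
        ∀ S : Set (EuclideanSpace ℝ (Fin 3)), MeasurableSet S → S ⊆ (Ω : Set _) → volume S < ⊤ →
          IntegrableOn (fun x => ∑ i : Fin 3, ‖Gw x (EuclideanSpace.single i (1:ℝ))‖ ^ 2) S volume ∧
          ∫ x in S, ∑ i : Fin 3, ‖Gw x (EuclideanSpace.single i (1:ℝ))‖ ^ 2 ≤
            3 * ((∫ x in S, ∑ i : Fin 3, ‖Gv x (EuclideanSpace.single i (1:ℝ))‖ ^ 2) +
              (∫ x in S, ∑ i : Fin 3, ‖Gu x (EuclideanSpace.single i (1:ℝ))‖ ^ 2) +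
              (M / (ρ₂ - ρ₁)) ^ 2 * ∫ x in S, ‖v x - u x‖ ^ 2) := by
  obtain ⟨M, hM0, hball⟩ := exists_ball_interpolant
  refine ⟨M, hM0, fun Ω u v Gu Gv hu hv hu1 hv1 hdu hdv y ρ₁ ρ₂ h1 h12 => ?_⟩
  obtain ⟨χ, w, Gw, hχs, hχ01, hgrad, hw, hGw, hW, hin, hout⟩ := hball Ω u v Gu Gv hu hv y ρ₁ ρ₂ h1 h12
  refine ⟨w, Gw, hW, fun x hx => norm_interpolant_le_one hχ01 hw (hu1 x hx) (hv1 x hx), hin, hout,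
    fun x => ⟨norm_interpolant_sub_left_le hχ01 hw x, norm_interpolant_sub_right_le hχ01 hw x⟩,
    fun x => dens_interpolant_le hχ01 hgrad hGw x, fun S hS hSΩ hSfin => ?_⟩
  exact setIntegral_dens_interpolant_le hu hv hu1 hv1 hdu hdv hχs hχ01 hgrad hw hGw hS hSΩ hSfin

end Summit.QuantumFields.YangMills.Theorems.PoincareLipschitzSobolevShellInterpolationBalls

end
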